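import Literature.Analysis.FluidPDE.EyinkUniformDefect
import Literature.Analysis.FluidPDE.NovackScalingLawsProofs
import HarnessLib

/-!
# The 4/5 and 8/15 laws from the 4/3 law and a uniform *transverse* Eyink defect

Topic: Analysis/FluidPDE, a complement to `Literature.Analysis.FluidPDE.EyinkUniformDefect`
(`Torus.HasUniformEyinkDefect`, `HasUniformEyinkDefect.tendsto_shellPairings`) and
`Literature.Analysis.FluidPDE.NovackScalingLawsProofs` (`Torus.integral_mixedFlux_eq_sub`: the
mixed shell pairing is the energy-flux pairing minus the longitudinal one, Pythagoras on the
sphere). Everything here is proved; no new definitions.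

## Main result

`Torus.hasFourFifthsLaw_of_hasFourThirdsLaw_of_uniformTransverse`: in dimension `d ≥ 2`, if
`u ∈ L³((0,T) × T^d)` (jointly measurable) satisfies the local 4/3 law with `D`
(`Torus.HasFourThirdsLaw T u D`) and Eyink's *transverse* mollified flux alone converges to `D`
uniformly over spherically symmetric unit-ball mollifiers
(`∫₀ᵀ∫ D_T^{ε,φ}(u) ψ → D ψ`, the `T`-half of `HasUniformEyinkDefect`), then both the local 4/5
law (`∫∫ ℓ⁻¹⨍(δu_L)³ψ → −(12/(d(d+2))) D ψ`) and the local 8/15 law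
(`∫∫ ℓ⁻¹⨍δu_L|δu_T|²ψ → −(4(d−1)/(d(d+2))) D ψ`) hold — the longitudinal approximant `D_L^ε` is not
needed. Corollaries in the vocabulary of the tree: `…hasFourFifthsLaw_of_uniformTransverse`.

This sharpens the hypotheses of `HasUniformEyinkDefect.hasFourFifthsLaw`: of Eyink's two scale-`ε`
balances (Eyink 2003, §2, (uuL-eq)/(uuT-eq), the tree's named facts
`Torus.eyink_longitudinal_balance`, `Torus.eyink_transverse_balance` of `EyinkBalance`) only the
transverse one is required downstream once the 4/3 law is available (from Duchon–Robert's scalar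
balance, `DuchonRobertUniformDefect` / `NovackBallAvgBalance`).

## Proof

As in `HasUniformEyinkDefect.tendsto_shellPairings`: with plateau mollifiers and the polar formula
`Torus.integral_eyinkApprox_eq`, transverse uniformity alone gives the relation
`g_T(ε) + 2∫₀¹x^{d-1}g_T(εx)dx → −(4(d−1)/d²) D ψ`, and the Volterra step
(`Torus.tendsto_volterra`) yields `g_T → L_T = −(4(d−1)/(d(d+2))) D ψ` (the 8/15 law); the 4/5 law
is then the 4/3 law minus the 8/15 law (`integral_mixedFlux_eq_sub`):
`−4/d + 4(d−1)/(d(d+2)) = −12/(d(d+2))`.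

## References

* G. L. Eyink, Nonlinearity 16 (2003) 137–145 = arXiv:nlin/0208004, §2 Thm. 1, Cor. 1 (the linear
  system (L-eq), (T-eq)). [Eyink2003]
* M. Novack, Nonlinearity 37 (2024) 095002 = arXiv:2310.01375, Thm. 1 (1.6b–c), §2 Step 2 (last
  paragraph: `|T_I v|² = |T_L v|² + |T_T v|²`). [Novack2024]
-/

noncomputable section

open MeasureTheory MeasureTheory.Measure TopologicalSpace Set Function Filter Topology Metric Module
open scoped InnerProductSpace RealInnerProductSpace ENNReal NNReal

namespace Literature.Analysis.FluidPDE.Torus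

variable {d : Type*} [Fintype d]

section Transverse

variable {T : ℝ} {u : ℝ → UnitAddTorus d → EuclideanSpace ℝ d} {D : STFunctional d}

/-- **The 4/5 and 8/15 laws from the 4/3 law and uniform convergence of Eyink's transverse flux
alone** (dimension `d ≥ 2`): if `u ∈ L³((0,T) × T^d)` is jointly measurable, `HasFourThirdsLaw T u D`
holds, and `∫₀ᵀ∫ D_T^{ε,φ}(u) ψ → D ψ` as `ε → 0⁺` uniformly over spherically symmetric unit-ball
mollifiers `φ`, then for every test function `ψ` supported in `(0,T) × T^d`
`∫₀ᵀ∫ ℓ⁻¹ ⨍ (δu_L(ℓω))³ dω ψ → −(12/(d(d+2))) D ψ` and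
`∫₀ᵀ∫ ℓ⁻¹ ⨍ δu_L |δu_T|²(ℓω) dω ψ → −(4(d−1)/(d(d+2))) D ψ` (Eyink 2003, Cor. 1; Novack 2024, Thm. 1
(1.6b–c)). [folklore] -/
theorem hasFourFifthsLaw_of_hasFourThirdsLaw_of_uniformTransverse (hn2 : 2 ≤ Fintype.card d)
    (h43 : HasFourThirdsLaw T u D)
    (hT : ∀ ψ : ℝ → UnitAddTorus d → ℝ, FunctionSpaces.Torus.IsSpaceTimeTestIoo T ψ →
      TendstoUniformlyOn
        (fun (ε : ℝ) (φ : EuclideanSpace ℝ d → ℝ) =>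
          ∫ t in Ioo 0 T, ∫ x, eyinkTransverseApprox φ ε (u t) x * ψ t x)
        (fun _ => D ψ) (𝓝[>] 0) {φ | IsRadialUnitBallMollifier φ})
    (hum : AEStronglyMeasurable (FunctionSpaces.Torus.stLift u) (volume.restrict (Ioo 0 T ×ˢ univ)))
    (hu3 : ∫⁻ t in Ioo 0 T, ∫⁻ x, ‖u t x‖ₑ ^ (3 : ℕ) < ∞)
    {ψ : ℝ → UnitAddTorus d → ℝ} (hψ : FunctionSpaces.Torus.IsSpaceTimeTestIoo T ψ) :
    Tendsto (fun ℓ => ∫ t in Ioo 0 T, ∫ x, ℓ⁻¹ * longitudinalFluxSphereAvg (u t) ℓ x * ψ t x)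
        (𝓝[>] 0) (𝓝 (-fourFifthsConst d * D ψ)) ∧
      Tendsto (fun ℓ => ∫ t in Ioo 0 T, ∫ x, ℓ⁻¹ * mixedFluxSphereAvg (u t) ℓ x * ψ t x)
        (𝓝[>] 0)
        (𝓝 (-(4 * ((Fintype.card d : ℝ) - 1) /
          ((Fintype.card d : ℝ) * ((Fintype.card d : ℝ) + 2))) * D ψ)) := by
  haveI : Nonempty d := Fintype.card_pos_iff.1 (by omega)
  -- product-measure form of the hypotheses
  set μp : Measure (ℝ × UnitAddTorus d) := (volume.restrict (Ioo 0 T)).prod volume with hμp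
  have hu : AEStronglyMeasurable (uncurry u) μp := aestronglyMeasurable_uncurry_prod_of_stLift_Ioo hum
  have hu3' : ∫⁻ p, ‖uncurry u p‖ₑ ^ 3 ∂μp < ∞ := lintegral_prod_enorm_pow_three_lt_top hu hu3
  have hψm : AEStronglyMeasurable (uncurry ψ) μp := hψ.continuous_uncurry.aestronglyMeasurable
  obtain ⟨Cψ, hψb⟩ := hψ.exists_abs_le
  -- the two cubic forms
  have hQTc : Continuous (uncurry fun (ω v : EuclideanSpace ℝ d) => ⟪v, ω⟫ * ‖v - ⟪v, ω⟫ • ω‖ ^ 2) :=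
    continuous_cubicFormT
  have hQT : ∀ ω v : EuclideanSpace ℝ d, ‖ω‖ ≤ 1 →
      |(fun (ω v : EuclideanSpace ℝ d) => ⟪v, ω⟫ * ‖v - ⟪v, ω⟫ • ω‖ ^ 2) ω v| ≤ 4 * ‖v‖ ^ 3 :=
    fun ω v hω => abs_cubicFormT_le v hω
  have h4 : (0 : ℝ) ≤ 4 := by norm_num
  -- dimension, surface area, a unit vector
  set n : ℕ := Fintype.card d with hndef
  have hn1 : 1 ≤ n := by omega
  have hn0 : (0 : ℝ) < n := by exact_mod_cast (by omega : 0 < n)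
  have hnR2 : (2 : ℝ) ≤ n := by exact_mod_cast hn2
  have hn0' : (n : ℝ) ≠ 0 := hn0.ne'
  have hn1' : (n : ℝ) - 1 ≠ 0 := by linarith
  have hn2' : (n : ℝ) + 2 ≠ 0 := by linarith
  set c : ℝ := (volume : Measure (EuclideanSpace ℝ d)).toSphere.real univ with hcdef
  have hc : 0 < c := toSphere_real_univ_pos
  obtain ⟨e₀, he₀⟩ : ∃ e : EuclideanSpace ℝ d, ‖e‖ = 1 := by
    classical
    obtain ⟨i⟩ := ‹Nonempty d›
    exact ⟨EuclideanSpace.single i 1, by simp⟩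
  -- the shell pairings (product form) and the shell functions `g_L`, `g_T`
  set IT : ℝ → ℝ := cubicShellPairing
    (fun (ω v : EuclideanSpace ℝ d) => ⟪v, ω⟫ * ‖v - ⟪v, ω⟫ • ω‖ ^ 2) T u ψ with hITdef
  set gT : ℝ → ℝ := fun r => r⁻¹ * IT r with hgTdef
  have hgTiter : ∀ ℓ, ∫ t in Ioo 0 T, ∫ x, ℓ⁻¹ * mixedFluxSphereAvg (u t) ℓ x * ψ t x = gT ℓ :=
    fun ℓ => integral_integral_sphereAvg_eq hu hu3' hψm hψb hQTc h4 hQT ℓ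
  have hITc : Continuous IT := continuous_cubicShellPairing_T hu hu3' hψm hψb
  have hgTc : ContinuousOn gT (Ioi 0) :=
    (continuousOn_inv₀.mono fun r hr => ne_of_gt hr).mul hITc.continuousOn
  -- integrability on `(0,1]` of `x ↦ x^{n-1} g_T(εx) = ε⁻¹ x^{n-2} I_T(εx)`
  have hpow : ∀ x : ℝ, x ≠ 0 → x ^ (n - 1) * x⁻¹ = x ^ (n - 2) := by
    intro x hx
    have : x ^ (n - 1) = x ^ (n - 2) * x := by
      rw [← pow_succ]; congr 1; omega
    rw [this, mul_assoc, mul_inv_cancel₀ hx, mul_one]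
  have hAint : ∀ ε, 0 < ε → IntegrableOn (fun x => x ^ (n - 1) * gT (ε * x)) (Ioc 0 1) := by
    intro ε hε
    obtain ⟨M, hM⟩ := (isCompact_Icc (a := (0 : ℝ)) (b := ε)).exists_bound_of_continuousOn
      hITc.continuousOn
    have hcont : ContinuousOn (fun x => x ^ (n - 1) * gT (ε * x)) (Ioc 0 1) :=
      ((continuous_pow _).continuousOn).mul
        ((hgTc.comp (continuous_const.mul continuous_id).continuousOn
          fun x hx => mul_pos hε hx).mono Ioc_subset_Ioi_self)
    refine IntegrableOn.of_bound measure_Ioc_lt_top (hcont.aestronglyMeasurable measurableSet_Ioc)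
      (ε⁻¹ * M) ?_
    refine (ae_restrict_mem measurableSet_Ioc).mono fun x hx => ?_
    have hx0 : 0 < x := hx.1
    have hεx : 0 < ε * x := mul_pos hε hx0
    have heq : x ^ (n - 1) * gT (ε * x) = ε⁻¹ * (x ^ (n - 2) * IT (ε * x)) := by
      simp only [hgTdef]
      rw [mul_inv, ← hpow x hx0.ne']
      ring
    rw [heq, norm_mul, Real.norm_eq_abs, abs_of_pos (inv_pos.2 hε), norm_mul, Real.norm_eq_abs,
      abs_of_nonneg (pow_nonneg hx0.le _)]
    gcongr
    calc x ^ (n - 2) * ‖IT (ε * x)‖ ≤ 1 * M := by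
          gcongr
          · exact pow_le_one₀ hx0.le hx.2
          · exact hM _ ⟨hεx.le, by nlinarith [hx.2]⟩
      _ = M := one_mul M
  -- the ball average `A(ε) = ∫_{(0,1]} x^{n-1} g_T(εx) dx`
  set A : ℝ → ℝ := fun ε => ∫ x in Ioc (0 : ℝ) 1, x ^ (n - 1) * gT (ε * x) with hAdef
  -- Step 1: the plateau mollifiers; polar formula and the `k → ∞` limits at fixed `ε > 0`
  have hm : ∀ k : ℕ, (1 : ℝ) < (k : ℝ) + 2 := fun k => by
    have : (0 : ℝ) ≤ k := Nat.cast_nonneg k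
    linarith
  set PT : ℕ → ℝ → ℝ := fun k ε =>
    ∫ t in Ioo 0 T, ∫ x, eyinkTransverseApprox (plateauMollifier d ((k : ℝ) + 2)) ε (u t) x * ψ t x
    with hPTdef
  set J1T : ℕ → ℝ → ℝ := fun k ε => ∫ x in Ioi (0 : ℝ), x ^ n *
    deriv (fun s : ℝ => plateauMollifier d ((k : ℝ) + 2) (s • e₀)) x * gT (ε * x) with hJ1Tdef
  set J2 : ℕ → ℝ → ℝ := fun k ε => ∫ x in Ioi (0 : ℝ), 2 * x ^ (n - 1) *
    plateauMollifier d ((k : ℝ) + 2) (x • e₀) * gT (ε * x) with hJ2def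
  have hP : ∀ (k : ℕ) (ε : ℝ), 0 < ε →
      PT k ε = eyinkTransverseConst d * c * (J1T k ε - J2 k ε) := fun k ε hε =>
    (integral_eyinkApprox_eq hn2 (isUnitBallMollifier_plateauMollifier (hm k)).1
      (fun x y hxy => plateauMollifier_radial _ hxy) (isUnitBallMollifier_plateauMollifier (hm k)).2
      he₀ hu hu3' hψm hψb hε).2
  have hJ1T : ∀ ε, 0 < ε → Tendsto (fun k => J1T k ε) atTop (𝓝 (-(n : ℝ) / c * gT ε)) :=
    fun ε hε => tendsto_integral_pow_mul_deriv_profile_mul he₀ hgTc hε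
  have hJ2 : ∀ ε, 0 < ε → Tendsto (fun k => J2 k ε) atTop (𝓝 ((n : ℝ) / c * (2 * A ε))) := by
    intro ε hε
    have hH : IntegrableOn (fun x => 2 * (x ^ (n - 1) * gT (ε * x))) (Ioc 0 1) :=
      (hAint ε hε).const_mul 2
    have hlim := tendsto_integral_plateauMollifier_profile_mul he₀ hH
    have h2A : ∫ x in Ioc (0 : ℝ) 1, 2 * (x ^ (n - 1) * gT (ε * x)) = 2 * A ε := integral_const_mul _ _
    rw [h2A] at hlim
    refine hlim.congr fun k => ?_
    simp only [hJ2def]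
    refine setIntegral_congr_fun measurableSet_Ioi fun x _ => ?_
    ring
  have hPTlim : ∀ ε, 0 < ε → Tendsto (fun k => PT k ε) atTop
      (𝓝 (eyinkTransverseConst d * c * (-(n : ℝ) / c * gT ε - (n : ℝ) / c * (2 * A ε)))) := by
    intro ε hε
    refine (((hJ1T ε hε).sub (hJ2 ε hε)).const_mul (eyinkTransverseConst d * c)).congr fun k => ?_
    exact (hP k ε hε).symm
  -- Step 2: uniformity in the mollifier ⇒ the `ε → 0⁺` limits of the right-hand sides
  have hUT : ∀ η > 0, ∃ ε₀ > 0, ∀ k, ∀ ε ∈ Ioo (0 : ℝ) ε₀, |PT k ε - D ψ| < η := by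
    intro η hη
    have h1 := (Metric.tendstoUniformlyOn_iff.1 (hT ψ hψ)) η hη
    obtain ⟨ε₀, hε₀, hsub⟩ := mem_nhdsGT_iff_exists_Ioo_subset.1 h1
    refine ⟨ε₀, hε₀, fun k ε hε => ?_⟩
    have h' := hsub hε _ (isRadialUnitBallMollifier_plateauMollifier (hm k))
    rwa [Real.dist_eq, abs_sub_comm] at h'
  have hΛT := tendsto_nhdsGT_of_forall_tendsto_atTop hUT hPTlim
  -- Step 3: the two relations
  have hE2 : Tendsto (fun ε => gT ε + 2 * A ε) (𝓝[>] 0)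
      (𝓝 (-(4 * ((n : ℝ) - 1) / (n : ℝ) ^ 2) * D ψ)) := by
    refine (hΛT.const_mul (-(4 * ((n : ℝ) - 1) / (n : ℝ) ^ 2))).congr fun ε => ?_
    simp only [eyinkTransverseConst, ← hndef]
    field_simp
    ring
  -- Step 4: the Volterra step for `g = g_T − L_T`
  set LT : ℝ := -(4 * ((n : ℝ) - 1) / ((n : ℝ) * ((n : ℝ) + 2))) * D ψ with hLTdef
  set g : ℝ → ℝ := fun r => gT r - LT with hgdef
  have hgc : ContinuousOn g (Ioi 0) := hgTc.sub continuousOn_const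
  obtain ⟨M, hM⟩ := (isCompact_Icc (a := (0 : ℝ)) (b := 1)).exists_bound_of_continuousOn
    hITc.continuousOn
  have hbd : ∀ r ∈ Ioc (0 : ℝ) 1, |r ^ (n - 1) * g r| ≤ M + |LT| := by
    intro r hr
    have hr0 : 0 < r := hr.1
    have heq : r ^ (n - 1) * g r = r ^ (n - 2) * IT r - r ^ (n - 1) * LT := by
      simp only [hgdef, hgTdef]
      rw [mul_sub, ← mul_assoc, hpow r hr0.ne']
    rw [heq]
    calc |r ^ (n - 2) * IT r - r ^ (n - 1) * LT| ≤ |r ^ (n - 2) * IT r| + |r ^ (n - 1) * LT| :=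
          abs_sub _ _
      _ = r ^ (n - 2) * |IT r| + r ^ (n - 1) * |LT| := by
          rw [abs_mul, abs_mul, abs_of_nonneg (pow_nonneg hr0.le _), abs_of_nonneg (pow_nonneg hr0.le _)]
      _ ≤ 1 * M + 1 * |LT| := by
          have hITr : |IT r| ≤ M := by
            have := hM r ⟨hr0.le, hr.2⟩
            rwa [Real.norm_eq_abs] at this
          gcongr
          · exact pow_le_one₀ hr0.le hr.2
          · exact pow_le_one₀ hr0.le hr.2
      _ = M + |LT| := by ring
  have hpowint : ∫ x in Ioc (0 : ℝ) 1, x ^ (n - 1) = 1 / n := by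
    rw [← intervalIntegral.integral_of_le zero_le_one, integral_pow]
    rw [one_pow, zero_pow (by omega), sub_zero, Nat.cast_sub hn1]
    push_cast
    ring
  have hAg : ∀ ε, 0 < ε → ∫ x in Ioc (0 : ℝ) 1, x ^ (n - 1) * g (ε * x) = A ε - LT / n := by
    intro ε hε
    have hi1 := hAint ε hε
    have hi2 : IntegrableOn (fun x : ℝ => x ^ (n - 1) * LT) (Ioc 0 1) :=
      ((continuous_pow _).mul continuous_const).continuousOn.integrableOn_compact isCompact_Icc
        |>.mono_set Ioc_subset_Icc_self
    have heq : (fun x => x ^ (n - 1) * g (ε * x)) = fun x => x ^ (n - 1) * gT (ε * x) - x ^ (n - 1) * LT := by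
      funext x; simp only [hgdef]; ring
    rw [heq, integral_sub hi1 hi2, integral_mul_const, hpowint]
    ring
  have hVhyp : Tendsto (fun ε => g ε + 2 * ∫ x in Ioc (0 : ℝ) 1, x ^ (n - 1) * g (ε * x))
      (𝓝[>] 0) (𝓝 0) := by
    have h1 : Tendsto (fun ε => (gT ε + 2 * A ε) - LT * (1 + 2 / n)) (𝓝[>] 0)
        (𝓝 (-(4 * ((n : ℝ) - 1) / (n : ℝ) ^ 2) * D ψ - LT * (1 + 2 / n))) := hE2.sub_const _
    have h0 : -(4 * ((n : ℝ) - 1) / (n : ℝ) ^ 2) * D ψ - LT * (1 + 2 / n) = 0 := by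
      simp only [hLTdef]
      field_simp
      ring
    rw [h0] at h1
    refine h1.congr' ?_
    filter_upwards [self_mem_nhdsWithin] with ε hε
    rw [hAg ε hε]
    simp only [hgdef]
    field_simp
    ring
  have hV := tendsto_volterra hn1 hgc hbd hVhyp
  -- Step 5: conclusions
  have hAlim : Tendsto A (𝓝[>] 0) (𝓝 (LT / n)) := by
    have h1 := hV.add_const (LT / n)
    rw [zero_add] at h1
    refine h1.congr' ?_
    filter_upwards [self_mem_nhdsWithin] with ε hε
    rw [hAg ε hε]
    ring
  have hgTlim : Tendsto gT (𝓝[>] 0) (𝓝 LT) := by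
    have h1 := hE2.sub (hAlim.const_mul 2)
    have h0 : -(4 * ((n : ℝ) - 1) / (n : ℝ) ^ 2) * D ψ - 2 * (LT / n) = LT := by
      simp only [hLTdef]
      field_simp
      ring
    rw [h0] at h1
    exact h1.congr fun ε => by ring
  -- the longitudinal pairing: 4/3 law minus the transverse limit (`|δu|² = (δu_L)² + |δu_T|²`)
  have hgIlim := h43 ψ hψ
  have hsplit : ∀ ℓ, ∫ t in Ioo 0 T, ∫ x, ℓ⁻¹ * longitudinalFluxSphereAvg (u t) ℓ x * ψ t x =
      (∫ t in Ioo 0 T, ∫ x, ℓ⁻¹ * energyFluxSphereAvg (u t) ℓ x * ψ t x) - gT ℓ := fun ℓ => by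
    rw [← hgTiter ℓ, integral_mixedFlux_eq_sub hu hu3' hψm hψb ℓ]
    ring
  have hgLlim : Tendsto (fun ℓ => ∫ t in Ioo 0 T, ∫ x, ℓ⁻¹ * longitudinalFluxSphereAvg (u t) ℓ x * ψ t x)
      (𝓝[>] 0) (𝓝 (-fourFifthsConst d * D ψ)) := by
    have h1 := hgIlim.sub hgTlim
    have h0 : -fourThirdsConst d * D ψ - LT = -fourFifthsConst d * D ψ := by
      simp only [hLTdef, fourThirdsConst, fourFifthsConst, ← hndef]
      field_simp
      ring
    rw [h0] at h1
    exact h1.congr fun ℓ => (hsplit ℓ).symm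
  refine ⟨hgLlim, ?_⟩
  rw [tendsto_congr hgTiter]
  exact hgTlim


/-- **The local 4/5 law from the 4/3 law and a uniform transverse Eyink defect** (`d ≥ 2`): under
the hypotheses of `hasFourFifthsLaw_of_hasFourThirdsLaw_of_uniformTransverse`,
`Torus.HasFourFifthsLaw T u D`. [folklore] -/
theorem HasFourThirdsLaw.hasFourFifthsLaw_of_uniformTransverse (hn2 : 2 ≤ Fintype.card d)
    (h43 : HasFourThirdsLaw T u D)
    (hT : ∀ ψ : ℝ → UnitAddTorus d → ℝ, FunctionSpaces.Torus.IsSpaceTimeTestIoo T ψ →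
      TendstoUniformlyOn
        (fun (ε : ℝ) (φ : EuclideanSpace ℝ d → ℝ) =>
          ∫ t in Ioo 0 T, ∫ x, eyinkTransverseApprox φ ε (u t) x * ψ t x)
        (fun _ => D ψ) (𝓝[>] 0) {φ | IsRadialUnitBallMollifier φ})
    (hum : AEStronglyMeasurable (FunctionSpaces.Torus.stLift u) (volume.restrict (Ioo 0 T ×ˢ univ)))
    (hu3 : ∫⁻ t in Ioo 0 T, ∫⁻ x, ‖u t x‖ₑ ^ (3 : ℕ) < ∞) :
    HasFourFifthsLaw T u D :=
  fun _ hψ => (hasFourFifthsLaw_of_hasFourThirdsLaw_of_uniformTransverse hn2 h43 hT hum hu3 hψ).1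

/-- **The local 8/15 law from the 4/3 law and a uniform transverse Eyink defect** (`d ≥ 2`). [folklore] -/
theorem HasFourThirdsLaw.tendsto_mixedFlux_of_uniformTransverse (hn2 : 2 ≤ Fintype.card d)
    (h43 : HasFourThirdsLaw T u D)
    (hT : ∀ ψ : ℝ → UnitAddTorus d → ℝ, FunctionSpaces.Torus.IsSpaceTimeTestIoo T ψ →
      TendstoUniformlyOn
        (fun (ε : ℝ) (φ : EuclideanSpace ℝ d → ℝ) =>
          ∫ t in Ioo 0 T, ∫ x, eyinkTransverseApprox φ ε (u t) x * ψ t x)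
        (fun _ => D ψ) (𝓝[>] 0) {φ | IsRadialUnitBallMollifier φ})
    (hum : AEStronglyMeasurable (FunctionSpaces.Torus.stLift u) (volume.restrict (Ioo 0 T ×ˢ univ)))
    (hu3 : ∫⁻ t in Ioo 0 T, ∫⁻ x, ‖u t x‖ₑ ^ (3 : ℕ) < ∞)
    {ψ : ℝ → UnitAddTorus d → ℝ} (hψ : FunctionSpaces.Torus.IsSpaceTimeTestIoo T ψ) :
    Tendsto (fun ℓ => ∫ t in Ioo 0 T, ∫ x, ℓ⁻¹ * mixedFluxSphereAvg (u t) ℓ x * ψ t x) (𝓝[>] 0)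
      (𝓝 (-(4 * ((Fintype.card d : ℝ) - 1) /
        ((Fintype.card d : ℝ) * ((Fintype.card d : ℝ) + 2))) * D ψ)) :=
  (hasFourFifthsLaw_of_hasFourThirdsLaw_of_uniformTransverse hn2 h43 hT hum hu3 hψ).2

end Transverse

end Literature.Analysis.FluidPDE.Torus
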